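import Literature.NumberTheory.LFunctions.ZetaScrewHermitianForms
import Literature.NumberTheory.LFunctions.ZetaScrewSeriesProofs
import Literature.NumberTheory.LFunctions.WeilZeroSum
import HarnessLib

/-!
# Suzuki JLMS 2023, eq. (3.1): the window form `⟨φ₁,φ₂⟩_{G_g,a}` as a series over the zeros — PROOF

LINE 1 — LABEL: RH-FREE corpus THEOREM (an unconditional identity; proof-only module, no definition,
no named fact). bears_on: LADDER-RH B-C/B-P (COLUMN 6 DBR). WHAT THIS IS NOT: no positivity is
asserted or used; (3.1) is the zero-side expansion of Suzuki's Hermitian form on integrable data —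
the input through which Thm 1.3 ("Moreover": definiteness on `L²(−a,a)` under RH) and Thm 1.4 read
the form off the zeros; nothing here bears on the truth of RH.

Source: M. Suzuki, *Aspects of the screw function corresponding to the Riemann zeta function*,
J. Lond. Math. Soc. (2) 108 (2023) 1448–1487 = arXiv:2206.03682 [`Suzuki2023`], §3.1, display
(3.1), p. 7 (held text `paper-arxiv-2206.03682` p0007:L17–36).

## The printed statement and the tree's coordinates

"For integrable functions `φ₁(t)` and `φ₂(t)` with `supp φᵢ ⊂ [−a,a]` (`i = 1, 2`),
`⟨φ₁,φ₂⟩_{G_g,a} = Σ_γ [(φ̂₁(−γ) − φ̂₁(0))/γ]·[((φ̄₂)^(γ) − (φ̄₂)^(0))/γ]`   (3.1)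
by (1.9)", where `φ̂(z) = ∫ φ(t)e^{izt} dt`, `γ` runs over the zeros of `ξ(½ − iz)` with multiplicity
and `⟨φ₁,φ₂⟩_{G_g,a} = ∫_{−a}^{a}∫_{−a}^{a} G_g(t,u)φ₁(u) conj φ₂(t) du dt` (= `zetaScrewForm (Ioo (−a) a) φ₁ φ₂`,
`ZetaScrewHermitianForms.lean`). In the tree the zeros are indexed by `ρ ∈ riemannZetaNontrivialZeros`
with multiplicity `m(ρ) = riemannZetaZeroOrder ρ` and `γ = i(ρ − ½)`; then
`e^{−iγu} = e^{(ρ−½)u}`, `e^{iγt} = e^{−(ρ−½)t}`, `γ² = −(ρ − ½)²`, so the `γ`-th term reads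
`m(ρ)·[∫_{(−a,a)} (e^{−(ρ−½)t} − 1) conj φ₂(t) dt]·[∫_{(−a,a)} (e^{(ρ−½)u} − 1) φ₁(u) du] / (−(ρ−½)²)` —
this is `Suzuki2023_eq301` (a `HasSum` over the subtype of non-trivial zeros; absolute convergence
`summable_norm_eq301_term`). "Integrable with support in `[−a,a]`" is rendered as
`IntegrableOn φᵢ (Ioo (−a) a)` (the form only sees the window).

## The printed proof ("by (1.9)") and this formalisation

* Steps 1–3 [folklore plumbing around cited inputs]: the kernel series (1.9) in the paired (cosh)
  form `G_g(t,u) = Σ_ρ m(ρ)[cosh wt + cosh wu − cosh w(t−u) − 1]/w²`, `w = ρ − ½`, from Thm 1.1 (2)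
  (`Suzuki2023_thm11_series_holds`, `ZetaScrewSeriesProofs.lean`); the window bound
  `|term_ρ| ≤ m(ρ)(3cosh a + 1)/|w|²` (`|Re w| ≤ ½`); `Σ_ρ m(ρ)/|ρ − ½|² < ∞` from the grouped
  Hadamard product of `ξ` (`Completed.xi_hadamard_product_grouped`) [Titchmarsh1986, §2.12].
* Step 4: the window integrals of an integrable `φ` against `e^{±wu}` and the closed form of
  `∫_{(−a,a)} brk(w;t,u)φ(u)du`; Step 5: dominated termwise integration (majorant
  `C(ρ)‖φ₂(t)‖‖φ₁(u)‖`, first in `u`, then in `t`) giving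
  `⟨φ₁,φ₂⟩_{G_g,a} = Σ_ρ ∫∫ term_ρ φ₁ conj φ₂` (`hasSum_setIntegral_setIntegral_kerTerm`).
* Step 6: each paired term is the average of the printed (separable) terms at `ρ` and `1 − ρ`
  (`setIntegral_setIntegral_kerTerm_eq_half`), and re-indexing by the involution `ρ ↦ 1 − ρ` of the
  zero multiset (`m(1−ρ) = m(ρ)`, `riemannZetaZeroOrder_one_sub_holds`) yields (3.1) as printed.

Downstream (not here): for `φ ∈ L²(−a,a) ⊂ L¹(−a,a)` and RH (`w = iγ`, `γ ∈ ℝ`) every term of (3.1)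
with `φ₁ = φ₂ = φ` equals `|∫(e^{iγu} − 1)φ(u)du|²/γ² ≥ 0` — the printed route to (3.2), the
"Moreover" clause of Thm 1.3 (`Suzuki2023_thm13_posdef`) and Thm 1.4 `⟹` (with Lemma 2.1,
`Suzuki2023_lemma21_holds`).
-/

noncomputable section

open MeasureTheory Set Filter Complex
open scoped ComplexConjugate Topology

namespace Literature.NumberTheory.LFunctions

namespace Suzuki2023Eq301

/-! ## Step 1. The kernel as a series over the zeros (from Thm 1.1 (2)) -/

/-- **(1.9), paired form**: `G_g(t,u) = Ψ(t) + Ψ(u) − Ψ(t−u) = Σ_ρ m(ρ)[cosh wt + cosh wu − cosh w(t−u) − 1]/w²`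
(`w = ρ − ½`), unconditionally, from Thm 1.1 (2) (`Suzuki2023_thm11_series_holds`) at `t`, `u`, `t − u`.
[cite: Suzuki2023, eq. (1.9), p. 3] -/
private theorem hasSum_kerTerm (t u : ℝ) :
    HasSum (fun ρ : ZetaZeros.riemannZetaNontrivialZeros ↦ ((riemannZetaZeroOrder (ρ : ℂ) : ℂ) *
              ((Complex.cosh (((ρ : ℂ) - 1 / 2) * t) + Complex.cosh (((ρ : ℂ) - 1 / 2) * u) -
                Complex.cosh (((ρ : ℂ) - 1 / 2) * (t - u)) - 1) / ((ρ : ℂ) - 1 / 2) ^ 2)))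
      (zetaScrewKernel t u : ℂ) := by
  have h := Suzuki2023_thm11_series_holds
  have hs := ((h t).add (h u)).sub (h (t - u))
  have e : (fun ρ : ZetaZeros.riemannZetaNontrivialZeros ↦ ((riemannZetaZeroOrder (ρ : ℂ) : ℂ) *
              ((Complex.cosh (((ρ : ℂ) - 1 / 2) * t) + Complex.cosh (((ρ : ℂ) - 1 / 2) * u) -
                Complex.cosh (((ρ : ℂ) - 1 / 2) * (t - u)) - 1) / ((ρ : ℂ) - 1 / 2) ^ 2))) =
      fun ρ : ZetaZeros.riemannZetaNontrivialZeros ↦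
        (riemannZetaZeroOrder (ρ : ℂ) : ℂ) *
            ((Complex.cosh (((ρ : ℂ) - 1 / 2) * t) - 1) / ((ρ : ℂ) - 1 / 2) ^ 2) +
          (riemannZetaZeroOrder (ρ : ℂ) : ℂ) *
            ((Complex.cosh (((ρ : ℂ) - 1 / 2) * u) - 1) / ((ρ : ℂ) - 1 / 2) ^ 2) -
          (riemannZetaZeroOrder (ρ : ℂ) : ℂ) *
            ((Complex.cosh (((ρ : ℂ) - 1 / 2) * ((t - u : ℝ) : ℂ)) - 1) / ((ρ : ℂ) - 1 / 2) ^ 2) := by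
    funext ρ
    push_cast
    ring
  have e2 : (zetaScrewKernel t u : ℂ) =
      (zetaScrew t : ℂ) + (zetaScrew u : ℂ) - (zetaScrew (t - u) : ℂ) := by
    rw [zetaScrewKernel]
    push_cast
    ring
  rw [e, e2]
  exact hs

/-! ## Step 2. Uniform bounds on the window -/

/-- `‖cosh z‖ ≤ cosh(Re z)`. [folklore] -/
private theorem norm_cosh_le_cosh_re (z : ℂ) : ‖Complex.cosh z‖ ≤ Real.cosh z.re := by
  rw [Complex.cosh, Real.cosh_eq, norm_div, Complex.norm_ofNat]
  gcongr
  calc ‖Complex.exp z + Complex.exp (-z)‖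
      ≤ ‖Complex.exp z‖ + ‖Complex.exp (-z)‖ := norm_add_le _ _
    _ = Real.exp z.re + Real.exp (-z.re) := by rw [Complex.norm_exp, Complex.norm_exp, neg_re]

/-- `‖cosh(w s)‖ ≤ cosh a` for `|Re w| ≤ ½` and `|s| ≤ 2a`. [folklore] -/
private theorem norm_cosh_mul_le {w : ℂ} (hw : |w.re| ≤ 1 / 2) {s a : ℝ} (hs : |s| ≤ 2 * a) :
    ‖Complex.cosh (w * s)‖ ≤ Real.cosh a := by
  refine (norm_cosh_le_cosh_re _).trans ?_
  rw [Real.cosh_le_cosh, re_mul_ofReal, abs_mul]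
  have ha : 0 ≤ a := by linarith [abs_nonneg s]
  rw [abs_of_nonneg ha]
  nlinarith [abs_nonneg w.re, abs_nonneg s]

/-- A non-trivial zero has `|Re ρ − ½| ≤ ½` (open critical strip). [folklore] -/
private theorem abs_re_sub_half_le {ρ : ℂ} (hρ : ρ ∈ ZetaZeros.riemannZetaNontrivialZeros) :
    |(ρ - 1 / 2).re| ≤ 1 / 2 := by
  have h0 := ZetaZeros.riemannZetaNontrivialZeros.re_pos hρ
  have h1 := ZetaZeros.riemannZetaNontrivialZeros.re_lt_one hρ
  rw [abs_le, sub_re]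
  norm_num
  constructor <;> linarith

/-- A non-trivial zero has `ρ ≠ ½` (it is off the real axis). [folklore] -/
private theorem sub_half_ne_zero {ρ : ℂ} (hρ : ρ ∈ ZetaZeros.riemannZetaNontrivialZeros) :
    ρ - 1 / 2 ≠ 0 := by
  intro h
  have him := ZetaZeros.riemannZetaNontrivialZeros.im_ne_zero hρ
  have : (ρ - 1 / 2).im = 0 := by rw [h, zero_im]
  rw [sub_im] at this
  norm_num at this
  exact him this

/-- On the window `|t|, |u| ≤ a`: `‖brk(w; t, u)‖ ≤ 3cosh a + 1` for `|Re w| ≤ ½`. [folklore] -/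
private theorem norm_brk_le {w : ℂ} (hw : |w.re| ≤ 1 / 2) {a t u : ℝ} (ht : |t| ≤ a) (hu : |u| ≤ a) :
    ‖(Complex.cosh (w * t) + Complex.cosh (w * u) - Complex.cosh (w * (t - u)) - 1)‖ ≤ 3 * Real.cosh a + 1 := by
  have ha : 0 ≤ a := (abs_nonneg t).trans ht
  have h1 : ‖Complex.cosh (w * t)‖ ≤ Real.cosh a := norm_cosh_mul_le hw (by linarith)
  have h2 : ‖Complex.cosh (w * u)‖ ≤ Real.cosh a := norm_cosh_mul_le hw (by linarith)
  have h3 : ‖Complex.cosh (w * (t - u))‖ ≤ Real.cosh a := by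
    have e : (w * (t - u) : ℂ) = w * ((t - u : ℝ) : ℂ) := by push_cast; ring
    rw [e]
    refine norm_cosh_mul_le hw ?_
    calc |t - u| ≤ |t| + |u| := abs_sub _ _
      _ ≤ 2 * a := by linarith
  calc ‖Complex.cosh (w * t) + Complex.cosh (w * u) - Complex.cosh (w * (t - u)) - 1‖
      ≤ ‖Complex.cosh (w * t)‖ + ‖Complex.cosh (w * u)‖ + ‖Complex.cosh (w * (t - u))‖ + ‖(1 : ℂ)‖ := by
        refine (norm_sub_le _ _).trans ?_
        gcongr
        refine (norm_sub_le _ _).trans ?_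
        gcongr
        exact norm_add_le _ _
    _ ≤ Real.cosh a + Real.cosh a + Real.cosh a + 1 := by rw [norm_one]; gcongr
    _ = 3 * Real.cosh a + 1 := by ring

/-- On the window `|t|, |u| ≤ a`: `‖kerTerm ρ t u‖ ≤ C(ρ) = m(ρ)(3cosh a + 1)/|ρ − ½|²`. [folklore] -/
private theorem norm_kerTerm_le {ρ : ℂ} (hρ : ρ ∈ ZetaZeros.riemannZetaNontrivialZeros) {a t u : ℝ}
    (ht : |t| ≤ a) (hu : |u| ≤ a) : ‖((riemannZetaZeroOrder (ρ : ℂ) : ℂ) *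
              ((Complex.cosh (((ρ : ℂ) - 1 / 2) * t) + Complex.cosh (((ρ : ℂ) - 1 / 2) * u) -
                Complex.cosh (((ρ : ℂ) - 1 / 2) * (t - u)) - 1) / ((ρ : ℂ) - 1 / 2) ^ 2))‖ ≤ ((riemannZetaZeroOrder (ρ : ℂ) : ℝ) * (3 * Real.cosh a + 1) / ‖(ρ : ℂ) - 1 / 2‖ ^ 2) := by
  have hm : (0 : ℝ) ≤ riemannZetaZeroOrder ρ := by
    exact_mod_cast riemannZetaZeroOrder_nonneg (ZetaZeros.riemannZetaNontrivialZeros.ne_one hρ)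
  have hw := sub_half_ne_zero hρ
  rw [norm_mul, norm_div, norm_pow, Complex.norm_intCast, abs_of_nonneg hm, mul_div_assoc]
  gcongr
  exact norm_brk_le (abs_re_sub_half_le hρ) ht hu

/-! ## Step 3. `Σ_ρ m(ρ)/|ρ − ½|² < ∞` (grouped Hadamard product of `ξ`) -/

/-- **`Σ_ρ m(ρ)/|ρ − ½|² < ∞`** over the non-trivial zeros with multiplicity (`= 4Σₙ‖bₙ‖` for a
Hadamard sequence `b` of `ξ`, regrouped by zeros with `IsHadamardSeq.hasSum_nontrivialZeros_of_hasSum_pairs`;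
Titchmarsh §9.2 / the convergence exponent of the zeros). [cite: Titchmarsh1986, §9.2, Thm. 9.2] -/
private theorem summable_order_div_norm_sub_half_sq :
    Summable fun ρ : ZetaZeros.riemannZetaNontrivialZeros ↦
      (riemannZetaZeroOrder (ρ : ℂ) : ℝ) / ‖(ρ : ℂ) - 1 / 2‖ ^ 2 := by
  obtain ⟨b, hb⟩ := exists_isHadamardSeq 0
  set G : ℂ → ℂ := fun ρ ↦ (((‖ρ - 1 / 2‖ ^ 2)⁻¹ : ℝ) : ℂ) with hG
  have hGsymm : ∀ ρ, G (1 - ρ) = G ρ := by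
    intro ρ
    simp only [hG]
    rw [show (1 - ρ - 1 / 2 : ℂ) = -(ρ - 1 / 2) by ring, norm_neg]
  have hpair : HasSum (fun n ↦ if b n = 0 then 0 else G (IsHadamardSeq.xiZero b n))
      (((∑' n, 4 * ‖b n‖ : ℝ) : ℂ)) := by
    have e : (fun n ↦ if b n = 0 then 0 else G (IsHadamardSeq.xiZero b n)) =
        fun n ↦ ((4 * ‖b n‖ : ℝ) : ℂ) := by
      funext n
      split_ifs with hn
      · simp [hn]
      · simp only [hG]
        rw [← norm_pow, IsHadamardSeq.xiZero_sub_half_sq, norm_div, norm_one, norm_mul,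
          Complex.norm_ofNat, one_div, inv_inv]
    rw [e]
    exact Complex.hasSum_ofReal.2 (hb.summable.mul_left 4).hasSum
  have h := hb.hasSum_nontrivialZeros_of_hasSum_pairs hGsymm hpair
  have h' := Complex.hasSum_re h
  refine h'.summable.congr fun ρ ↦ ?_
  simp only [hG, mul_re, ofReal_re, ofReal_im, mul_zero, sub_zero, intCast_re, div_eq_mul_inv]

/-- `Σ_ρ C(ρ) < ∞`. [folklore] -/
private theorem summable_C (a : ℝ) :
    Summable fun ρ : ZetaZeros.riemannZetaNontrivialZeros ↦ ((riemannZetaZeroOrder (ρ : ℂ) : ℝ) * (3 * Real.cosh a + 1) / ‖(ρ : ℂ) - 1 / 2‖ ^ 2) := by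
  refine (summable_order_div_norm_sub_half_sq.mul_right (3 * Real.cosh a + 1)).congr fun ρ ↦ ?_
  ring



/-! ## Step 4. Window integrals of integrable functions against bounded exponentials -/

variable {a : ℝ} {φ φ₁ φ₂ : ℝ → ℂ}

/-- `‖e^{vx}‖ ≤ e^{a/2}` for `|Re v| ≤ ½`, `|x| ≤ a`. [folklore] -/
private theorem norm_cexp_mul_le {v : ℂ} (hv : |v.re| ≤ 1 / 2) {x : ℝ} (hx : |x| ≤ a) :
    ‖cexp (v * x)‖ ≤ Real.exp (a / 2) := by
  rw [Complex.norm_exp, Real.exp_le_exp, re_mul_ofReal]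
  have ha : 0 ≤ a := (abs_nonneg x).trans hx
  calc v.re * x ≤ |v.re * x| := le_abs_self _
    _ = |v.re| * |x| := abs_mul _ _
    _ ≤ 1 / 2 * a := by gcongr
    _ = a / 2 := by ring

/-- A continuous function times an integrable one is integrable on the window `(−a, a)`. [folklore] -/
private theorem integrableOn_continuous_mul {g : ℝ → ℂ} (hg : Continuous g)
    (hφ : IntegrableOn φ (Ioo (-a) a)) : IntegrableOn (fun x ↦ g x * φ x) (Ioo (-a) a) :=
  IntegrableOn.continuousOn_mul_of_subset hg.continuousOn hφ isCompact_Icc measurableSet_Ioo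
    Ioo_subset_Icc_self

/-- `conj φ` is integrable on the window when `φ` is. [folklore] -/
private theorem integrableOn_conj (hφ : IntegrableOn φ (Ioo (-a) a)) :
    IntegrableOn (fun x ↦ conj (φ x)) (Ioo (-a) a) := by
  have h := (Complex.conjCLE.toContinuousLinearEquiv.toContinuousLinearMap).integrable_comp hφ
  show Integrable (fun x ↦ conj (φ x)) (volume.restrict (Ioo (-a) a))
  simpa using h

/-- The bracket split into a `u`-independent part and separable exponentials:
`brk = (cosh wt − 1) + ½[(1 − e^{−wt})e^{wu} + (1 − e^{wt})e^{−wu}]`. [folklore] -/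
private theorem brk_eq (w : ℂ) (t u : ℝ) :
    (Complex.cosh (w * t) + Complex.cosh (w * u) - Complex.cosh (w * (t - u)) - 1) = (Complex.cosh (w * t) - 1) +
      1 / 2 * ((1 - cexp (-w * t)) * cexp (w * u) + (1 - cexp (w * t)) * cexp (-w * u)) := by
  have e1 : cexp (w * (t - u)) = cexp (w * t) * cexp (-w * u) := by
    rw [← Complex.exp_add]; congr 1; ring
  have e2 : cexp (-(w * (t - u))) = cexp (-w * t) * cexp (w * u) := by
    rw [← Complex.exp_add]; congr 1; ring
  have e3 : cexp (-(w * u)) = cexp (-w * u) := by rw [neg_mul]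
  simp only [Complex.cosh]
  rw [e1, e2, e3]
  ring

/-- `cosh(wt) = ½(e^{wt} + e^{−wt})` with the exponentials written as `cexp (±w * t)`. [folklore] -/
private theorem cosh_eq_half (w : ℂ) (t : ℝ) :
    Complex.cosh (w * t) = 1 / 2 * (cexp (w * t) + cexp (-w * t)) := by
  rw [Complex.cosh, neg_mul]
  ring

/-- Inner window integral of the bracket against an integrable `φ`:
`∫_{(−a,a)} brk(w;t,u) φ(u) du = (cosh wt − 1)·∫φ + ½(1 − e^{−wt})·∫e^{wu}φ + ½(1 − e^{wt})·∫e^{−wu}φ`.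
[cite: Suzuki2023, eq. (3.1), p. 7] -/
theorem setIntegral_brk_mul (hφ : IntegrableOn φ (Ioo (-a) a)) (w : ℂ) (t : ℝ) :
    ∫ u in Ioo (-a) a, (Complex.cosh (w * t) + Complex.cosh (w * u) - Complex.cosh (w * (t - u)) - 1) * φ u =
      (Complex.cosh (w * t) - 1) * (∫ u in Ioo (-a) a, φ u) +
        1 / 2 * (1 - cexp (-w * t)) * (∫ u in Ioo (-a) a, cexp (w * u) * φ u) +
          1 / 2 * (1 - cexp (w * t)) * (∫ u in Ioo (-a) a, cexp (-w * u) * φ u) := by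
  have hIp : IntegrableOn (fun u : ℝ ↦ cexp (w * u) * φ u) (Ioo (-a) a) :=
    integrableOn_continuous_mul (by fun_prop) hφ
  have hIm : IntegrableOn (fun u : ℝ ↦ cexp (-w * u) * φ u) (Ioo (-a) a) :=
    integrableOn_continuous_mul (by fun_prop) hφ
  have hI0 : IntegrableOn (fun u : ℝ ↦ (Complex.cosh (w * t) - 1) * φ u) (Ioo (-a) a) :=
    hφ.const_mul _
  have hI1 : IntegrableOn (fun u : ℝ ↦ 1 / 2 * (1 - cexp (-w * t)) * (cexp (w * u) * φ u))
      (Ioo (-a) a) := hIp.const_mul _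
  have hI2 : IntegrableOn (fun u : ℝ ↦ 1 / 2 * (1 - cexp (w * t)) * (cexp (-w * u) * φ u))
      (Ioo (-a) a) := hIm.const_mul _
  have hI12 : IntegrableOn (fun u : ℝ ↦ 1 / 2 * (1 - cexp (-w * t)) * (cexp (w * u) * φ u) +
      1 / 2 * (1 - cexp (w * t)) * (cexp (-w * u) * φ u)) (Ioo (-a) a) := hI1.add hI2
  have e : (fun u : ℝ ↦ (Complex.cosh (w * t) + Complex.cosh (w * u) - Complex.cosh (w * (t - u)) - 1) * φ u) = fun u ↦
      (Complex.cosh (w * t) - 1) * φ u +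
        (1 / 2 * (1 - cexp (-w * t)) * (cexp (w * u) * φ u) +
          1 / 2 * (1 - cexp (w * t)) * (cexp (-w * u) * φ u)) := by
    funext u
    rw [brk_eq]
    ring
  rw [e, integral_add hI0 hI12, integral_add hI1 hI2, integral_const_mul, integral_const_mul,
    integral_const_mul]
  ring

/-- The window double integral of the `ρ`-th kernel term against `φ₁(u) conj φ₂(t)`, in closed form
through the six window integrals `∫φ₁`, `∫e^{±wu}φ₁`, `∫conj φ₂`, `∫e^{±wt}conj φ₂`.
[cite: Suzuki2023, eq. (3.1), p. 7] -/
theorem setIntegral_setIntegral_kerTerm (hφ₁ : IntegrableOn φ₁ (Ioo (-a) a))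
    (hφ₂ : IntegrableOn φ₂ (Ioo (-a) a)) (ρ : ℂ) :
    ∫ t in Ioo (-a) a, ∫ u in Ioo (-a) a, ((riemannZetaZeroOrder (ρ : ℂ) : ℂ) *
              ((Complex.cosh (((ρ : ℂ) - 1 / 2) * t) + Complex.cosh (((ρ : ℂ) - 1 / 2) * u) -
                Complex.cosh (((ρ : ℂ) - 1 / 2) * (t - u)) - 1) / ((ρ : ℂ) - 1 / 2) ^ 2)) * φ₁ u * conj (φ₂ t) =
      (riemannZetaZeroOrder ρ : ℂ) / (ρ - 1 / 2) ^ 2 *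
        ((1 / 2 * ((∫ t in Ioo (-a) a, cexp ((ρ - 1 / 2) * t) * conj (φ₂ t)) +
              (∫ t in Ioo (-a) a, cexp (-(ρ - 1 / 2) * t) * conj (φ₂ t))) -
            (∫ t in Ioo (-a) a, conj (φ₂ t))) * (∫ u in Ioo (-a) a, φ₁ u) +
          1 / 2 * ((∫ t in Ioo (-a) a, conj (φ₂ t)) -
              (∫ t in Ioo (-a) a, cexp (-(ρ - 1 / 2) * t) * conj (φ₂ t))) *
            (∫ u in Ioo (-a) a, cexp ((ρ - 1 / 2) * u) * φ₁ u) +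
          1 / 2 * ((∫ t in Ioo (-a) a, conj (φ₂ t)) -
              (∫ t in Ioo (-a) a, cexp ((ρ - 1 / 2) * t) * conj (φ₂ t))) *
            (∫ u in Ioo (-a) a, cexp (-(ρ - 1 / 2) * u) * φ₁ u)) := by
  set w : ℂ := ρ - 1 / 2 with hw_def
  set m : ℂ := (riemannZetaZeroOrder ρ : ℂ) with hm
  set Z₁ : ℂ := ∫ u in Ioo (-a) a, φ₁ u with hZ₁
  set E₁p : ℂ := ∫ u in Ioo (-a) a, cexp (w * u) * φ₁ u with hE₁p
  set E₁m : ℂ := ∫ u in Ioo (-a) a, cexp (-w * u) * φ₁ u with hE₁m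
  -- inner integral
  have inner : ∀ t : ℝ, ∫ u in Ioo (-a) a, (m * ((Complex.cosh (w * t) + Complex.cosh (w * u) - Complex.cosh (w * (t - u)) - 1) / w ^ 2)) * φ₁ u * conj (φ₂ t) =
      (m / w ^ 2 * conj (φ₂ t)) * ((Complex.cosh (w * t) - 1) * Z₁ +
        1 / 2 * (1 - cexp (-w * t)) * E₁p + 1 / 2 * (1 - cexp (w * t)) * E₁m) := by
    intro t
    have e : (fun u : ℝ ↦ (m * ((Complex.cosh (w * t) + Complex.cosh (w * u) - Complex.cosh (w * (t - u)) - 1) / w ^ 2)) * φ₁ u * conj (φ₂ t)) = fun u : ℝ ↦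
        (m / w ^ 2 * conj (φ₂ t)) * ((Complex.cosh (w * t) + Complex.cosh (w * u) - Complex.cosh (w * (t - u)) - 1) * φ₁ u) := by
      funext u
      ring
    rw [e, integral_const_mul, setIntegral_brk_mul hφ₁]
  simp_rw [inner]
  -- outer integral: expand into the three window integrals of `conj φ₂` against `1`, `e^{wt}`, `e^{-wt}`
  have hc : IntegrableOn (fun t : ℝ ↦ conj (φ₂ t)) (Ioo (-a) a) := integrableOn_conj hφ₂
  have hcp : IntegrableOn (fun t : ℝ ↦ cexp (w * t) * conj (φ₂ t)) (Ioo (-a) a) :=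
    integrableOn_continuous_mul (by fun_prop) hc
  have hcm : IntegrableOn (fun t : ℝ ↦ cexp (-w * t) * conj (φ₂ t)) (Ioo (-a) a) :=
    integrableOn_continuous_mul (by fun_prop) hc
  set c₀ : ℂ := m / w ^ 2 * (-Z₁ + 1 / 2 * E₁p + 1 / 2 * E₁m) with hc₀
  set cp : ℂ := m / w ^ 2 * (1 / 2 * Z₁ - 1 / 2 * E₁m) with hcp_def
  set cm : ℂ := m / w ^ 2 * (1 / 2 * Z₁ - 1 / 2 * E₁p) with hcm_def
  have hJ0 : IntegrableOn (fun t : ℝ ↦ c₀ * conj (φ₂ t)) (Ioo (-a) a) := hc.const_mul _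
  have hJ1 : IntegrableOn (fun t : ℝ ↦ cp * (cexp (w * t) * conj (φ₂ t))) (Ioo (-a) a) :=
    hcp.const_mul _
  have hJ2 : IntegrableOn (fun t : ℝ ↦ cm * (cexp (-w * t) * conj (φ₂ t))) (Ioo (-a) a) :=
    hcm.const_mul _
  have hJ12 : IntegrableOn (fun t : ℝ ↦ cp * (cexp (w * t) * conj (φ₂ t)) +
      cm * (cexp (-w * t) * conj (φ₂ t))) (Ioo (-a) a) := hJ1.add hJ2
  have e : (fun t : ℝ ↦ (m / w ^ 2 * conj (φ₂ t)) * ((Complex.cosh (w * t) - 1) * Z₁ +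
      1 / 2 * (1 - cexp (-w * t)) * E₁p + 1 / 2 * (1 - cexp (w * t)) * E₁m)) = fun t ↦
      c₀ * conj (φ₂ t) + (cp * (cexp (w * t) * conj (φ₂ t)) + cm * (cexp (-w * t) * conj (φ₂ t))) := by
    funext t
    rw [cosh_eq_half]
    simp only [hc₀, hcp_def, hcm_def]
    ring
  rw [e, integral_add hJ0 hJ12, integral_add hJ1 hJ2, integral_const_mul, integral_const_mul,
    integral_const_mul, hc₀, hcp_def, hcm_def]
  have ew : -w = -(ρ - 1 / 2) := by rw [hw_def]
  simp only [neg_mul] at *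
  ring

/-! ## Step 5. Termwise integration on the window (majorant `C(ρ)‖φ₂(t)‖‖φ₁(u)‖`, `Σ C(ρ) < ∞`) -/

/-- `u ↦ kerTerm ρ t u` is continuous. [folklore] -/
private theorem continuous_kerTerm_right (ρ : ℂ) (t : ℝ) : Continuous fun u : ℝ ↦ ((riemannZetaZeroOrder (ρ : ℂ) : ℂ) *
              ((Complex.cosh (((ρ : ℂ) - 1 / 2) * t) + Complex.cosh (((ρ : ℂ) - 1 / 2) * u) -
                Complex.cosh (((ρ : ℂ) - 1 / 2) * (t - u)) - 1) / ((ρ : ℂ) - 1 / 2) ^ 2)) := by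
  have h1 : Continuous fun u : ℝ ↦ Complex.cosh ((ρ - 1 / 2) * u) :=
    Complex.continuous_cosh.comp (continuous_const.mul Complex.continuous_ofReal)
  have h2 : Continuous fun u : ℝ ↦ Complex.cosh ((ρ - 1 / 2) * (t - u)) :=
    Complex.continuous_cosh.comp (continuous_const.mul
      (continuous_const.sub Complex.continuous_ofReal))
  exact continuous_const.mul ((((continuous_const.add h1).sub h2).sub continuous_const).div_const _)

/-- The `u`-window-integral of the `ρ`-th kernel term against `φ₁(u) conj φ₂(t)`, closed form.
[cite: Suzuki2023, eq. (3.1), p. 7] -/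
theorem setIntegral_kerTerm_mul (hφ₁ : IntegrableOn φ₁ (Ioo (-a) a)) (φ₂ : ℝ → ℂ) (ρ : ℂ)
    (t : ℝ) :
    ∫ u in Ioo (-a) a, ((riemannZetaZeroOrder (ρ : ℂ) : ℂ) *
              ((Complex.cosh (((ρ : ℂ) - 1 / 2) * t) + Complex.cosh (((ρ : ℂ) - 1 / 2) * u) -
                Complex.cosh (((ρ : ℂ) - 1 / 2) * (t - u)) - 1) / ((ρ : ℂ) - 1 / 2) ^ 2)) * φ₁ u * conj (φ₂ t) =
      ((riemannZetaZeroOrder ρ : ℂ) / (ρ - 1 / 2) ^ 2 * conj (φ₂ t)) *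
        ((Complex.cosh ((ρ - 1 / 2) * t) - 1) * (∫ u in Ioo (-a) a, φ₁ u) +
          1 / 2 * (1 - cexp (-(ρ - 1 / 2) * t)) * (∫ u in Ioo (-a) a, cexp ((ρ - 1 / 2) * u) * φ₁ u) +
          1 / 2 * (1 - cexp ((ρ - 1 / 2) * t)) *
            (∫ u in Ioo (-a) a, cexp (-(ρ - 1 / 2) * u) * φ₁ u)) := by
  have e : (fun u : ℝ ↦ ((riemannZetaZeroOrder (ρ : ℂ) : ℂ) *
              ((Complex.cosh (((ρ : ℂ) - 1 / 2) * t) + Complex.cosh (((ρ : ℂ) - 1 / 2) * u) -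
                Complex.cosh (((ρ : ℂ) - 1 / 2) * (t - u)) - 1) / ((ρ : ℂ) - 1 / 2) ^ 2)) * φ₁ u * conj (φ₂ t)) = fun u : ℝ ↦
      ((riemannZetaZeroOrder ρ : ℂ) / (ρ - 1 / 2) ^ 2 * conj (φ₂ t)) *
        ((Complex.cosh ((ρ - 1 / 2) * t) + Complex.cosh ((ρ - 1 / 2) * u) -
          Complex.cosh ((ρ - 1 / 2) * (t - u)) - 1) * φ₁ u) := by
    funext u
    ring
  rw [e, integral_const_mul, setIntegral_brk_mul hφ₁]

/-- **Termwise integration of (1.9) over the window, for integrable `φ₁, φ₂`**: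
`⟨φ₁,φ₂⟩_{G_g,a} = Σ_ρ ∫∫_{(−a,a)²} kerTerm_ρ(t,u) φ₁(u) conj φ₂(t) du dt`, the series converging
(absolutely): dominated summation with majorant `C(ρ)‖φ₂(t)‖‖φ₁(u)‖`, first in `u`, then in `t`
(the step "by (1.9)" of the printed (3.1)). [cite: Suzuki2023, eq. (3.1), p. 7] -/
theorem hasSum_setIntegral_setIntegral_kerTerm (hφ₁ : IntegrableOn φ₁ (Ioo (-a) a))
    (hφ₂ : IntegrableOn φ₂ (Ioo (-a) a)) :
    HasSum (fun ρ : ZetaZeros.riemannZetaNontrivialZeros ↦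
        ∫ t in Ioo (-a) a, ∫ u in Ioo (-a) a, ((riemannZetaZeroOrder (ρ : ℂ) : ℂ) *
              ((Complex.cosh (((ρ : ℂ) - 1 / 2) * t) + Complex.cosh (((ρ : ℂ) - 1 / 2) * u) -
                Complex.cosh (((ρ : ℂ) - 1 / 2) * (t - u)) - 1) / ((ρ : ℂ) - 1 / 2) ^ 2)) * φ₁ u * conj (φ₂ t))
      (zetaScrewForm (Ioo (-a) a) φ₁ φ₂) := by
  set S : Set ℝ := Ioo (-a) a with hS
  set F : ZetaZeros.riemannZetaNontrivialZeros → ℝ → ℝ → ℂ :=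
    fun ρ t u ↦ ((riemannZetaZeroOrder (ρ : ℂ) : ℂ) *
              ((Complex.cosh (((ρ : ℂ) - 1 / 2) * t) + Complex.cosh (((ρ : ℂ) - 1 / 2) * u) -
                Complex.cosh (((ρ : ℂ) - 1 / 2) * (t - u)) - 1) / ((ρ : ℂ) - 1 / 2) ^ 2)) * φ₁ u * conj (φ₂ t) with hF
  have habs : ∀ {x : ℝ}, x ∈ S → |x| ≤ a := fun hx ↦ abs_le.2 ⟨hx.1.le, hx.2.le⟩
  -- pointwise expansion of the integrand
  have hpt : ∀ t u : ℝ, (zetaScrewKernel t u : ℂ) * φ₁ u * conj (φ₂ t) =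
      ∑' ρ : ZetaZeros.riemannZetaNontrivialZeros, F ρ t u := fun t u ↦
    (((hasSum_kerTerm t u).mul_right (φ₁ u)).mul_right (conj (φ₂ t))).tsum_eq.symm
  -- majorant on the window
  have hbound : ∀ (ρ : ZetaZeros.riemannZetaNontrivialZeros) {t u : ℝ}, t ∈ S → u ∈ S →
      ‖F ρ t u‖ ≤ ((riemannZetaZeroOrder (ρ : ℂ) : ℝ) * (3 * Real.cosh a + 1) / ‖(ρ : ℂ) - 1 / 2‖ ^ 2) * (‖φ₂ t‖ * ‖φ₁ u‖) := by
    intro ρ t u ht hu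
    have hk := norm_kerTerm_le (a := a) (t := t) (u := u) ρ.2 (habs ht) (habs hu)
    simp only [hF]
    rw [norm_mul, norm_mul, Complex.norm_conj]
    have h1 := norm_nonneg (φ₁ u)
    have h2 := norm_nonneg (φ₂ t)
    nlinarith [mul_nonneg h1 h2, hk]
  -- integrability in `u` (for every `t`)
  have hint : ∀ (ρ : ZetaZeros.riemannZetaNontrivialZeros) (t : ℝ),
      IntegrableOn (fun u ↦ F ρ t u) S := by
    intro ρ t
    have e : (fun u ↦ F ρ t u) = fun u : ℝ ↦ (conj (φ₂ t) * ((riemannZetaZeroOrder (ρ : ℂ) : ℂ) *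
              ((Complex.cosh (((ρ : ℂ) - 1 / 2) * t) + Complex.cosh (((ρ : ℂ) - 1 / 2) * u) -
                Complex.cosh (((ρ : ℂ) - 1 / 2) * (t - u)) - 1) / ((ρ : ℂ) - 1 / 2) ^ 2))) * φ₁ u := by
      funext u; simp only [hF]; ring
    rw [e]
    exact integrableOn_continuous_mul (continuous_const.mul (continuous_kerTerm_right ρ t)) hφ₁
  set L₁ : ℝ := ∫ u in S, ‖φ₁ u‖ with hL₁
  set L₂ : ℝ := ∫ t in S, ‖φ₂ t‖ with hL₂
  have hL₁int : IntegrableOn (fun u : ℝ ↦ ‖φ₁ u‖) S := hφ₁.norm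
  have hL₂int : IntegrableOn (fun t : ℝ ↦ ‖φ₂ t‖) S := hφ₂.norm
  -- bound on the inner norm integrals, `t ∈ S`
  have hinner_le : ∀ (ρ : ZetaZeros.riemannZetaNontrivialZeros) {t : ℝ}, t ∈ S →
      ∫ u in S, ‖F ρ t u‖ ≤ ((riemannZetaZeroOrder (ρ : ℂ) : ℝ) * (3 * Real.cosh a + 1) / ‖(ρ : ℂ) - 1 / 2‖ ^ 2) * ‖φ₂ t‖ * L₁ := by
    intro ρ t ht
    calc ∫ u in S, ‖F ρ t u‖ ≤ ∫ u in S, ((riemannZetaZeroOrder (ρ : ℂ) : ℝ) * (3 * Real.cosh a + 1) / ‖(ρ : ℂ) - 1 / 2‖ ^ 2) * (‖φ₂ t‖ * ‖φ₁ u‖) :=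
          integral_mono_ae (hint ρ t).norm ((hL₁int.const_mul _).const_mul _)
            ((ae_restrict_iff' measurableSet_Ioo).2 (Eventually.of_forall fun u hu ↦ hbound ρ ht hu))
      _ = ((riemannZetaZeroOrder (ρ : ℂ) : ℝ) * (3 * Real.cosh a + 1) / ‖(ρ : ℂ) - 1 / 2‖ ^ 2) * ‖φ₂ t‖ * L₁ := by
          rw [integral_const_mul, integral_const_mul, hL₁, mul_assoc]
  -- inner interchange, `t ∈ S`
  have hswap₁ : ∀ t ∈ S, ∫ u in S, (∑' ρ : ZetaZeros.riemannZetaNontrivialZeros, F ρ t u) =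
      ∑' ρ : ZetaZeros.riemannZetaNontrivialZeros, ∫ u in S, F ρ t u := by
    intro t ht
    refine (integral_tsum_of_summable_integral_norm (fun ρ ↦ hint ρ t) ?_).symm
    exact Summable.of_nonneg_of_le (fun ρ ↦ integral_nonneg fun u ↦ norm_nonneg _)
      (fun ρ ↦ hinner_le ρ ht) (((summable_C a).mul_right _).mul_right _)
  -- integrability in `t` of the inner integrals (closed form)
  have hJ : ∀ ρ : ZetaZeros.riemannZetaNontrivialZeros, IntegrableOn (fun t ↦ ∫ u in S, F ρ t u) S := by
    intro ρ
    have e : (fun t ↦ ∫ u in S, F ρ t u) = fun t : ℝ ↦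
        ((riemannZetaZeroOrder (ρ : ℂ) : ℂ) / ((ρ : ℂ) - 1 / 2) ^ 2 *
          ((Complex.cosh (((ρ : ℂ) - 1 / 2) * t) - 1) * (∫ u in Ioo (-a) a, φ₁ u) +
            1 / 2 * (1 - cexp (-((ρ : ℂ) - 1 / 2) * t)) *
              (∫ u in Ioo (-a) a, cexp (((ρ : ℂ) - 1 / 2) * u) * φ₁ u) +
            1 / 2 * (1 - cexp (((ρ : ℂ) - 1 / 2) * t)) *
              (∫ u in Ioo (-a) a, cexp (-((ρ : ℂ) - 1 / 2) * u) * φ₁ u))) * conj (φ₂ t) := by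
      funext t
      simp only [hF, hS]
      rw [setIntegral_kerTerm_mul hφ₁ φ₂ ρ t]
      ring
    rw [e]
    refine integrableOn_continuous_mul ?_ (integrableOn_conj hφ₂)
    have h1 : Continuous fun t : ℝ ↦ Complex.cosh (((ρ : ℂ) - 1 / 2) * t) :=
      Complex.continuous_cosh.comp (continuous_const.mul Complex.continuous_ofReal)
    have h2 : Continuous fun t : ℝ ↦ cexp (-((ρ : ℂ) - 1 / 2) * t) := by fun_prop
    have h3 : Continuous fun t : ℝ ↦ cexp (((ρ : ℂ) - 1 / 2) * t) := by fun_prop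
    exact continuous_const.mul ((((h1.sub continuous_const).mul continuous_const).add
      ((continuous_const.mul (continuous_const.sub h2)).mul continuous_const)).add
      ((continuous_const.mul (continuous_const.sub h3)).mul continuous_const))
  have hJ_le : ∀ ρ : ZetaZeros.riemannZetaNontrivialZeros,
      ∫ t in S, ‖∫ u in S, F ρ t u‖ ≤ ((riemannZetaZeroOrder (ρ : ℂ) : ℝ) * (3 * Real.cosh a + 1) / ‖(ρ : ℂ) - 1 / 2‖ ^ 2) * L₁ * L₂ := by
    intro ρ
    calc ∫ t in S, ‖∫ u in S, F ρ t u‖ ≤ ∫ t in S, ((riemannZetaZeroOrder (ρ : ℂ) : ℝ) * (3 * Real.cosh a + 1) / ‖(ρ : ℂ) - 1 / 2‖ ^ 2) * ‖φ₂ t‖ * L₁ :=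
          integral_mono_ae (hJ ρ).norm ((hL₂int.const_mul _).mul_const _)
            ((ae_restrict_iff' measurableSet_Ioo).2 (Eventually.of_forall fun t ht ↦
              (norm_integral_le_integral_norm _).trans (hinner_le ρ ht)))
      _ = ((riemannZetaZeroOrder (ρ : ℂ) : ℝ) * (3 * Real.cosh a + 1) / ‖(ρ : ℂ) - 1 / 2‖ ^ 2) * L₁ * L₂ := by
          rw [integral_mul_const, integral_const_mul, hL₂]
          ring
  have hJsum : Summable fun ρ : ZetaZeros.riemannZetaNontrivialZeros ↦ ∫ t in S, ‖∫ u in S, F ρ t u‖ :=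
    Summable.of_nonneg_of_le (fun ρ ↦ integral_nonneg fun _ ↦ norm_nonneg _) hJ_le
      (((summable_C a).mul_right _).mul_right _)
  have hswap₂ : ∫ t in S, (∑' ρ : ZetaZeros.riemannZetaNontrivialZeros, ∫ u in S, F ρ t u) =
      ∑' ρ : ZetaZeros.riemannZetaNontrivialZeros, ∫ t in S, ∫ u in S, F ρ t u :=
    (integral_tsum_of_summable_integral_norm hJ hJsum).symm
  -- summability of the double integrals
  have hsum : Summable fun ρ : ZetaZeros.riemannZetaNontrivialZeros ↦ ∫ t in S, ∫ u in S, F ρ t u := by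
    refine Summable.of_norm (Summable.of_nonneg_of_le (fun ρ ↦ norm_nonneg _) (fun ρ ↦ ?_) hJsum)
    exact norm_integral_le_integral_norm _
  -- assemble
  have e1 : zetaScrewForm S φ₁ φ₂ =
      ∫ t in S, ∑' ρ : ZetaZeros.riemannZetaNontrivialZeros, ∫ u in S, F ρ t u := by
    unfold zetaScrewForm
    refine setIntegral_congr_fun measurableSet_Ioo fun t ht ↦ ?_
    rw [← hswap₁ t ht]
    exact congrArg (fun f : ℝ → ℂ ↦ ∫ u in S, f u) (funext fun u ↦ hpt t u)
  rw [e1, hswap₂]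
  exact hsum.hasSum

/-! ## Step 6. Eq. (3.1): the printed (separable) form of the terms -/

/-- `∫_{(−a,a)} (e^{vx} − 1) f(x) dx = ∫ e^{vx}f − ∫ f` for `f` integrable on the window. [folklore] -/
private theorem setIntegral_cexp_sub_one_mul (hφ : IntegrableOn φ (Ioo (-a) a)) (v : ℂ) :
    ∫ x in Ioo (-a) a, (cexp (v * x) - 1) * φ x =
      (∫ x in Ioo (-a) a, cexp (v * x) * φ x) - ∫ x in Ioo (-a) a, φ x := by
  have h1 : IntegrableOn (fun x : ℝ ↦ cexp (v * x) * φ x) (Ioo (-a) a) :=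
    integrableOn_continuous_mul (by fun_prop) hφ
  rw [← integral_sub h1 hφ]
  refine integral_congr_ae (Eventually.of_forall fun x ↦ ?_)
  simp only
  ring

/-- Norm bound for the window transforms: `‖∫_{(−a,a)} (e^{vx} − 1) f‖ ≤ (e^{a/2} + 1) ∫_{(−a,a)} ‖f‖`
for `|Re v| ≤ ½`. [folklore] -/
private theorem norm_setIntegral_cexp_sub_one_mul_le (hφ : IntegrableOn φ (Ioo (-a) a)) {v : ℂ}
    (hv : |v.re| ≤ 1 / 2) :
    ‖∫ x in Ioo (-a) a, (cexp (v * x) - 1) * φ x‖ ≤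
      (Real.exp (a / 2) + 1) * ∫ x in Ioo (-a) a, ‖φ x‖ := by
  rw [← integral_const_mul]
  refine norm_integral_le_of_norm_le (hφ.norm.const_mul _)
    ((ae_restrict_iff' measurableSet_Ioo).2 (Eventually.of_forall fun x hx ↦ ?_))
  have hxa : |x| ≤ a := abs_le.2 ⟨hx.1.le, hx.2.le⟩
  rw [norm_mul]
  gcongr
  calc ‖cexp (v * x) - 1‖ ≤ ‖cexp (v * x)‖ + ‖(1 : ℂ)‖ := norm_sub_le _ _
    _ ≤ Real.exp (a / 2) + 1 := by rw [norm_one]; gcongr; exact norm_cexp_mul_le hv hxa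

/-- Absolute convergence of the printed series (3.1): the `ρ`-th term is
`≤ m(ρ)(e^{a/2}+1)²‖φ₁‖₁‖φ₂‖₁/|ρ − ½|²`. [cite: Suzuki2023, eq. (3.1), p. 7] -/
theorem summable_norm_eq301_term (hφ₁ : IntegrableOn φ₁ (Ioo (-a) a))
    (hφ₂ : IntegrableOn φ₂ (Ioo (-a) a)) :
    Summable fun ρ : ZetaZeros.riemannZetaNontrivialZeros ↦ ‖((riemannZetaZeroOrder (ρ : ℂ) : ℂ) *
          ((∫ t in Ioo (-a) a, (cexp (-((ρ : ℂ) - 1 / 2) * t) - 1) * conj (φ₂ t)) *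
            (∫ u in Ioo (-a) a, (cexp (((ρ : ℂ) - 1 / 2) * u) - 1) * φ₁ u)) /
          (-((ρ : ℂ) - 1 / 2) ^ 2))‖ := by
  set L₁ : ℝ := ∫ u in Ioo (-a) a, ‖φ₁ u‖ with hL₁
  set L₂ : ℝ := ∫ t in Ioo (-a) a, ‖conj (φ₂ t)‖ with hL₂
  have hc : IntegrableOn (fun t : ℝ ↦ conj (φ₂ t)) (Ioo (-a) a) := integrableOn_conj hφ₂
  refine Summable.of_nonneg_of_le (fun _ ↦ norm_nonneg _) (fun ρ ↦ ?_)
    ((summable_order_div_norm_sub_half_sq.mul_right ((Real.exp (a / 2) + 1) * L₂)).mul_right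
      ((Real.exp (a / 2) + 1) * L₁))
  have hw := abs_re_sub_half_le ρ.2
  have hw' : |(-((ρ : ℂ) - 1 / 2)).re| ≤ 1 / 2 := by rwa [neg_re, abs_neg]
  have hm : (0 : ℝ) ≤ riemannZetaZeroOrder (ρ : ℂ) := by
    exact_mod_cast riemannZetaZeroOrder_nonneg (ZetaZeros.riemannZetaNontrivialZeros.ne_one ρ.2)
  have b2 := norm_setIntegral_cexp_sub_one_mul_le hc hw'
  have b1 := norm_setIntegral_cexp_sub_one_mul_le hφ₁ hw
  rw [norm_div, norm_mul, norm_mul, norm_neg, norm_pow, Complex.norm_intCast, abs_of_nonneg hm,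
    div_eq_mul_inv]
  calc (riemannZetaZeroOrder (ρ : ℂ) : ℝ) *
        (‖∫ t in Ioo (-a) a, (cexp (-((ρ : ℂ) - 1 / 2) * t) - 1) * conj (φ₂ t)‖ *
          ‖∫ u in Ioo (-a) a, (cexp (((ρ : ℂ) - 1 / 2) * u) - 1) * φ₁ u‖) *
        (‖(ρ : ℂ) - 1 / 2‖ ^ 2)⁻¹
      ≤ (riemannZetaZeroOrder (ρ : ℂ) : ℝ) * (((Real.exp (a / 2) + 1) * L₂) *
          ((Real.exp (a / 2) + 1) * L₁)) * (‖(ρ : ℂ) - 1 / 2‖ ^ 2)⁻¹ := by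
        gcongr
    _ = (riemannZetaZeroOrder (ρ : ℂ) : ℝ) / ‖(ρ : ℂ) - 1 / 2‖ ^ 2 *
          ((Real.exp (a / 2) + 1) * L₂) * ((Real.exp (a / 2) + 1) * L₁) := by ring

/-- The double window integral of the `ρ`-th (paired) kernel term is the average of the printed
(3.1)-terms at `ρ` and at `1 − ρ` (`w ↦ −w`). [cite: Suzuki2023, eq. (3.1), p. 7] -/
theorem setIntegral_setIntegral_kerTerm_eq_half (hφ₁ : IntegrableOn φ₁ (Ioo (-a) a))
    (hφ₂ : IntegrableOn φ₂ (Ioo (-a) a)) {ρ : ℂ} (hρ : ρ ∈ ZetaZeros.riemannZetaNontrivialZeros) :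
    ∫ t in Ioo (-a) a, ∫ u in Ioo (-a) a, ((riemannZetaZeroOrder (ρ : ℂ) : ℂ) *
              ((Complex.cosh (((ρ : ℂ) - 1 / 2) * t) + Complex.cosh (((ρ : ℂ) - 1 / 2) * u) -
                Complex.cosh (((ρ : ℂ) - 1 / 2) * (t - u)) - 1) / ((ρ : ℂ) - 1 / 2) ^ 2)) * φ₁ u * conj (φ₂ t) =
      1 / 2 * (((riemannZetaZeroOrder (ρ : ℂ) : ℂ) *
          ((∫ t in Ioo (-a) a, (cexp (-((ρ : ℂ) - 1 / 2) * t) - 1) * conj (φ₂ t)) *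
            (∫ u in Ioo (-a) a, (cexp (((ρ : ℂ) - 1 / 2) * u) - 1) * φ₁ u)) /
          (-((ρ : ℂ) - 1 / 2) ^ 2)) + ((riemannZetaZeroOrder (ρ : ℂ) : ℂ) *
          ((∫ t in Ioo (-a) a, (cexp (((ρ : ℂ) - 1 / 2) * t) - 1) * conj (φ₂ t)) *
            (∫ u in Ioo (-a) a, (cexp (-((ρ : ℂ) - 1 / 2) * u) - 1) * φ₁ u)) /
          (-((ρ : ℂ) - 1 / 2) ^ 2))) := by
  have hw := sub_half_ne_zero hρ
  have hc : IntegrableOn (fun t : ℝ ↦ conj (φ₂ t)) (Ioo (-a) a) := integrableOn_conj hφ₂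
  rw [setIntegral_setIntegral_kerTerm hφ₁ hφ₂ ρ, setIntegral_cexp_sub_one_mul hc,
    setIntegral_cexp_sub_one_mul hc, setIntegral_cexp_sub_one_mul hφ₁,
    setIntegral_cexp_sub_one_mul hφ₁]
  field_simp
  ring

/-- `1 − ρ` is a non-trivial zero when `ρ` is (functional equation + conjugation). [folklore] -/
private theorem one_sub_mem {ρ : ℂ} (h : ρ ∈ ZetaZeros.riemannZetaNontrivialZeros) :
    1 - ρ ∈ ZetaZeros.riemannZetaNontrivialZeros := by
  have h1 := ZetaZeros.riemannZetaNontrivialZeros.one_sub_conj_mem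
    (ZetaZeros.riemannZetaNontrivialZeros.conj_mem h)
  simpa using h1

end Suzuki2023Eq301

open Suzuki2023Eq301 in
/-- RH-FREE · **Suzuki2023, eq. (3.1)** ("For integrable functions `φ₁(t)` and `φ₂(t)` with
`supp φᵢ ⊂ [−a,a]` (`i = 1,2`), `⟨φ₁,φ₂⟩_{G_g,a} = Σ_γ γ⁻¹(φ̂₁(−γ) − φ̂₁(0)) · γ⁻¹((φ̄₂)^(γ) − (φ̄₂)^(0))`
by (1.9)", `φ̂(z) = ∫φ(t)e^{izt}dt`), in the tree's coordinates: for `φ₁, φ₂` integrable on `(−a,a)`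
the series over the non-trivial zeros `ρ` (multiplicity `m(ρ)`, `γ = i(ρ − ½)`, so that
`e^{−iγu} = e^{(ρ−½)u}`, `e^{iγt} = e^{−(ρ−½)t}`, `γ² = −(ρ−½)²`) of
`m(ρ) · [∫_{(−a,a)}(e^{−(ρ−½)t} − 1) conj φ₂(t) dt] · [∫_{(−a,a)}(e^{(ρ−½)u} − 1) φ₁(u) du] / (−(ρ−½)²)`
converges (absolutely, `summable_norm_eq301_term`) to `⟨φ₁,φ₂⟩_{G_g,a} = zetaScrewForm (Ioo (−a) a) φ₁ φ₂`.
Proof as printed: the kernel series (1.9) (`Suzuki2023_thm11_series_holds`) summed under the window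
integral (dominated summation), each term separating into the two window transforms; the pairing
`ρ ↔ 1 − ρ` (`m(1−ρ) = m(ρ)`) passes from the symmetric (cosh) form of (1.9) to the printed terms.
[cite: Suzuki2023, eq. (3.1), p. 7 (held text p0007:L17–36)] -/
theorem Suzuki2023_eq301 {a : ℝ} {φ₁ φ₂ : ℝ → ℂ} (hφ₁ : IntegrableOn φ₁ (Ioo (-a) a))
    (hφ₂ : IntegrableOn φ₂ (Ioo (-a) a)) :
    HasSum (fun ρ : ZetaZeros.riemannZetaNontrivialZeros ↦ ((riemannZetaZeroOrder (ρ : ℂ) : ℂ) *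
          ((∫ t in Ioo (-a) a, (cexp (-((ρ : ℂ) - 1 / 2) * t) - 1) * conj (φ₂ t)) *
            (∫ u in Ioo (-a) a, (cexp (((ρ : ℂ) - 1 / 2) * u) - 1) * φ₁ u)) /
          (-((ρ : ℂ) - 1 / 2) ^ 2))) (zetaScrewForm (Ioo (-a) a) φ₁ φ₂) := by
  -- the involution `ρ ↦ 1 − ρ`
  let e : ZetaZeros.riemannZetaNontrivialZeros ≃ ZetaZeros.riemannZetaNontrivialZeros :=
    { toFun := fun ρ ↦ ⟨1 - (ρ : ℂ), one_sub_mem ρ.2⟩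
      invFun := fun ρ ↦ ⟨1 - (ρ : ℂ), one_sub_mem ρ.2⟩
      left_inv := fun ρ ↦ by ext; simp
      right_inv := fun ρ ↦ by ext; simp }
  have hT : HasSum (fun ρ : ZetaZeros.riemannZetaNontrivialZeros ↦ ((riemannZetaZeroOrder (ρ : ℂ) : ℂ) *
          ((∫ t in Ioo (-a) a, (cexp (-((ρ : ℂ) - 1 / 2) * t) - 1) * conj (φ₂ t)) *
            (∫ u in Ioo (-a) a, (cexp (((ρ : ℂ) - 1 / 2) * u) - 1) * φ₁ u)) /
          (-((ρ : ℂ) - 1 / 2) ^ 2)))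
      (∑' ρ : ZetaZeros.riemannZetaNontrivialZeros, ((riemannZetaZeroOrder (ρ : ℂ) : ℂ) *
          ((∫ t in Ioo (-a) a, (cexp (-((ρ : ℂ) - 1 / 2) * t) - 1) * conj (φ₂ t)) *
            (∫ u in Ioo (-a) a, (cexp (((ρ : ℂ) - 1 / 2) * u) - 1) * φ₁ u)) /
          (-((ρ : ℂ) - 1 / 2) ^ 2))) :=
    (summable_norm_eq301_term hφ₁ hφ₂).of_norm.hasSum
  -- the reflected family is the same family re-indexed by `e`
  have key : (fun ρ : ZetaZeros.riemannZetaNontrivialZeros ↦ ((riemannZetaZeroOrder (ρ : ℂ) : ℂ) *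
          ((∫ t in Ioo (-a) a, (cexp (((ρ : ℂ) - 1 / 2) * t) - 1) * conj (φ₂ t)) *
            (∫ u in Ioo (-a) a, (cexp (-((ρ : ℂ) - 1 / 2) * u) - 1) * φ₁ u)) /
          (-((ρ : ℂ) - 1 / 2) ^ 2))) =
      (fun ρ : ZetaZeros.riemannZetaNontrivialZeros ↦ ((riemannZetaZeroOrder (ρ : ℂ) : ℂ) *
          ((∫ t in Ioo (-a) a, (cexp (-((ρ : ℂ) - 1 / 2) * t) - 1) * conj (φ₂ t)) *
            (∫ u in Ioo (-a) a, (cexp (((ρ : ℂ) - 1 / 2) * u) - 1) * φ₁ u)) /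
          (-((ρ : ℂ) - 1 / 2) ^ 2))) ∘ e := by
    funext ρ
    simp only [Function.comp_apply, e, Equiv.coe_fn_mk]
    rw [riemannZetaZeroOrder_one_sub_holds (ZetaZeros.riemannZetaNontrivialZeros.re_pos ρ.2)
      (ZetaZeros.riemannZetaNontrivialZeros.re_lt_one ρ.2)]
    have ew : (1 - (ρ : ℂ) - 1 / 2) = -((ρ : ℂ) - 1 / 2) := by ring
    simp only [ew, neg_neg, neg_sq]
  have hT' : HasSum (fun ρ : ZetaZeros.riemannZetaNontrivialZeros ↦ ((riemannZetaZeroOrder (ρ : ℂ) : ℂ) *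
          ((∫ t in Ioo (-a) a, (cexp (((ρ : ℂ) - 1 / 2) * t) - 1) * conj (φ₂ t)) *
            (∫ u in Ioo (-a) a, (cexp (-((ρ : ℂ) - 1 / 2) * u) - 1) * φ₁ u)) /
          (-((ρ : ℂ) - 1 / 2) ^ 2)))
      (∑' ρ : ZetaZeros.riemannZetaNontrivialZeros, ((riemannZetaZeroOrder (ρ : ℂ) : ℂ) *
          ((∫ t in Ioo (-a) a, (cexp (-((ρ : ℂ) - 1 / 2) * t) - 1) * conj (φ₂ t)) *
            (∫ u in Ioo (-a) a, (cexp (((ρ : ℂ) - 1 / 2) * u) - 1) * φ₁ u)) /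
          (-((ρ : ℂ) - 1 / 2) ^ 2))) := by
    rw [key]
    exact (e.hasSum_iff).2 hT
  have hhalf : HasSum (fun ρ : ZetaZeros.riemannZetaNontrivialZeros ↦ (1 / 2 : ℂ) * (((riemannZetaZeroOrder (ρ : ℂ) : ℂ) *
          ((∫ t in Ioo (-a) a, (cexp (-((ρ : ℂ) - 1 / 2) * t) - 1) * conj (φ₂ t)) *
            (∫ u in Ioo (-a) a, (cexp (((ρ : ℂ) - 1 / 2) * u) - 1) * φ₁ u)) /
          (-((ρ : ℂ) - 1 / 2) ^ 2)) + ((riemannZetaZeroOrder (ρ : ℂ) : ℂ) *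
          ((∫ t in Ioo (-a) a, (cexp (((ρ : ℂ) - 1 / 2) * t) - 1) * conj (φ₂ t)) *
            (∫ u in Ioo (-a) a, (cexp (-((ρ : ℂ) - 1 / 2) * u) - 1) * φ₁ u)) /
          (-((ρ : ℂ) - 1 / 2) ^ 2))))
      ((1 / 2 : ℂ) * ((∑' ρ : ZetaZeros.riemannZetaNontrivialZeros, ((riemannZetaZeroOrder (ρ : ℂ) : ℂ) *
          ((∫ t in Ioo (-a) a, (cexp (-((ρ : ℂ) - 1 / 2) * t) - 1) * conj (φ₂ t)) *
            (∫ u in Ioo (-a) a, (cexp (((ρ : ℂ) - 1 / 2) * u) - 1) * φ₁ u)) /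
          (-((ρ : ℂ) - 1 / 2) ^ 2))) +
        ∑' ρ : ZetaZeros.riemannZetaNontrivialZeros, ((riemannZetaZeroOrder (ρ : ℂ) : ℂ) *
          ((∫ t in Ioo (-a) a, (cexp (-((ρ : ℂ) - 1 / 2) * t) - 1) * conj (φ₂ t)) *
            (∫ u in Ioo (-a) a, (cexp (((ρ : ℂ) - 1 / 2) * u) - 1) * φ₁ u)) /
          (-((ρ : ℂ) - 1 / 2) ^ 2)))) := (hT.add hT').mul_left _
  have hker := hasSum_setIntegral_setIntegral_kerTerm hφ₁ hφ₂
  have hker' : HasSum (fun ρ : ZetaZeros.riemannZetaNontrivialZeros ↦ (1 / 2 : ℂ) * (((riemannZetaZeroOrder (ρ : ℂ) : ℂ) *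
          ((∫ t in Ioo (-a) a, (cexp (-((ρ : ℂ) - 1 / 2) * t) - 1) * conj (φ₂ t)) *
            (∫ u in Ioo (-a) a, (cexp (((ρ : ℂ) - 1 / 2) * u) - 1) * φ₁ u)) /
          (-((ρ : ℂ) - 1 / 2) ^ 2)) + ((riemannZetaZeroOrder (ρ : ℂ) : ℂ) *
          ((∫ t in Ioo (-a) a, (cexp (((ρ : ℂ) - 1 / 2) * t) - 1) * conj (φ₂ t)) *
            (∫ u in Ioo (-a) a, (cexp (-((ρ : ℂ) - 1 / 2) * u) - 1) * φ₁ u)) /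
          (-((ρ : ℂ) - 1 / 2) ^ 2))))
      (zetaScrewForm (Ioo (-a) a) φ₁ φ₂) :=
    hker.congr_fun fun ρ ↦ (setIntegral_setIntegral_kerTerm_eq_half hφ₁ hφ₂ ρ.2).symm
  have heq := hhalf.unique hker'
  rw [← heq]
  convert hT using 1
  ring


end Literature.NumberTheory.LFunctions

end
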